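import Summits.QuantumFields.BalabanUV.T4Continuum.Support.NE7TopNormalisedQbarLetters
import Summits.QuantumFields.BalabanUV.T4Continuum.Support.NE7TopDbarFieldAtPair
import HarnessLib

/-!
# Support | NE7 (gen 98, ROAD-Γ′ S2′ preparation — THE DIRECT LETTERS OF THE RIGHT-INVERSE ARGUMENT UNDER `hdbar` ALONE): in the [B7]-Prop-4 regime at a unitary `W`, if the TOP
# DOUBLE-BAR FIELD of the perturbation is trivial (`dbavgCovIter L W (relPert W X) (j+1) = 1`), then `logCovIter … (j+1) = 0`, `QbarIter L (j+1) W X` IS row NE3's R26′ remainder, and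
# F326's two direct letters (DL1)∕(DL2) hold with the k-FREE constants of gen 97 — NO pair data, NO corner-triviality of a gauge; and `hdbar` follows at a pair for ANY unitary gauge `u`
# whose CORNER VALUES equal the accumulated frame (`vcov … = uLev L u (j+1)`, row NE3's `dbar_of_frame_eq`)

Cell `pub-balaban`, rung (B)+1 sub-cell t4, lineage `b2b-balaban-t4-ne7-p1` (CRUX PROVER NE7 #1 = OWNER of row NE7), generation 98; memo `t4/b2b-balaban-t4-ne7-p1-g98/ROAD-G98.md` §2.8.
Over gen 96's (Γ1) letters `NE7QbarIterL1DbarFree.dirL1_QbarIter_sub_le`, `NE7QbarIterL2DbarFree.sqrt_l2sq_QbarIter_sub_le` (NE3's R26′ towers WITHOUT `hdbar`: the subtracted field is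
`Ad_{Ū}⁻¹ logCovIter_{j+1}`), the [B7]-Prop-4 dictionary `B7Eq123General.dbavgCovIter_eq_expCfg_logCovIter` + `NE3.QbarTowerB8.logCovIter_succ_eq_mlog_dbavgCovIter`, gen 97's energy
bookkeeping `NE7TopNormalisedQbarLetters.pow_identity_L1 ∕ pow_identity_L2 ∕ inv_sq_mul_l2sq_le_energySq`, and row NE3's `NE3.PairFrameCondition.dbar_of_frame_eq`.

WHY (memo §2.8).  Gen 97's `NE7TopNormalisedQbarLetters.directLetter_L1∕L2_of_frameTrivial` read the (Γ1) letters at a pair through gen 96's entry point, which needs a CORNER-TRIVIAL gauge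
(`hcorner`) and a trivial accumulated frame (`v_{j+1} ≡ 1`).  ROAD-Γ′'s repaired top normalisation S2′ rotates the corners (`u(L^{j+1}•z) = v_{j+1}(z)`, the gauge is NOT corner-trivial);
what it delivers is exactly `hdbar` (row NE3's `dbar_of_frame_eq`: frame = corner values ⟹ `U̿′^{j+1} = 1`).  THIS FILE shows that `hdbar` ALONE suffices for the R-part letters: under
`hdbar` the top composite `logCovIter_{j+1} = mlog U̿′^{j+1} = 0` (Prop-4 dictionary), so the field subtracted in (Γ1) vanishes and (DL1)∕(DL2) follow verbatim — for every unitary `u`, with or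
without corner-triviality; gen 97's `_of_frameTrivial` versions are the special case `u` corner-trivial, `v ≡ 1`.
WHAT ([folklore]; 0 def, 0 sorry).  §1 `logCovIter_top_eq_zero_of_dbar`; §2 `dirL1_QbarIter_le_of_dbar`, `sqrt_l2sq_QbarIter_le_of_dbar` (R26′ verbatim); §3 **`directLetter_L1_of_dbar`**,
**`directLetter_L2_of_dbar`** ((DL1)∕(DL2) in the energy currency, k-free constants of gen 97); §4 `dbar_of_frame_eq_corner` (row NE3's frame condition at NE7's pair, any unitary `u`).
HONEST FRAMING (page 1): composition of landed kernel theorems; nothing of Bałaban's asserted; S2′ (the corner-rotating top normalisation), `hdecomp♭` and NE7 are NOT proved; spine 0∕9; finite T⁴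
rung (B)+1 — NOT infinite volume, NOT mass gap, NOT `BetaPertH`, NOT Clay.  Continuum YM on T⁴ ⇐ BetaPertH ∧ nine spine estimates (0/9 proved); BetaPertH ⇐ (D1) ∧ (D4) ∧ CAP+tail; G-an2-4
gates asym, D1 and NE2/3/4.
-/

set_option autoImplicit false

open scoped BigOperators Matrix Matrix.Norms.L2Operator
open NormedSpace Finset

namespace Summit.QuantumFields.BalabanUV.T4Continuum.NE7DbarQbarLetters

open Literature.MathematicalPhysics.QuantumFieldTheory.Balaban1983to89
open B7Prop1Explicit B7Prop2Explicit B7Prop3Flat MatrixLog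
open T4AveragingDeficitWall (Ad IsUnitaryCfg SmallField vary dirL1 dirSq curlSq)
open T4AveragingDeficitWallBoundary (IsPeriodicCfg periodBox)
open AveragingDeficitPeriodicCounting (IsPeriodicDir)
open AveragingDeficitMultiLevelPrep (cavgIter LevelSmall)
open AveragingDeficitNearIdentity (Ad_zero)
open B7AvgGaugeCovariance (uLev)
open B7Eq92Concrete (vcov dbavgCovIter)
open B7Prop4GeneralLevels (logCovIter)
open B7Eq123General (dbavgCovIter_eq_expCfg_logCovIter)
open NE3TangentCovariantTower (QbarIter)
open NE3CovariantLineSumsL2 (l2sq l2sq_nonneg)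
open NE3.PairLandauB8Avg (relPert)
open NE3.QbarDictionary (adField relPert_eq_expCfg_adField)
open NE3.QbarTowerB8 (logCovIter_succ_eq_mlog_dbavgCovIter)
open NE3.PairFrameCondition (dbar_of_frame_eq)
open ReplicationRightInverseBound (radSum)
open BlockAverageVaryHolo (nbRad)
open NE3CovariantLineSumsError (Csup)
open ShellMeasureAverageProp4General (C1cov C1cov_pos)
open NE3EnergyWeightedShapes (energyNormW energyNormW_nonneg)
open NE7QbarIterL1DbarFree (dirL1_QbarIter_sub_le)
open NE7QbarIterL2DbarFree (sqrt_l2sq_QbarIter_sub_le)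
open NE7TopNormalisedQbarLetters (pow_identity_L1 pow_identity_L2 inv_sq_mul_l2sq_le_energySq)

noncomputable section

variable {d : ℕ} {n : Type*} [Fintype n] [DecidableEq n]

/-! ## §1 Under `hdbar` the top composite vanishes -/

/-- **`hdbar` ⟹ `logCovIter_{j+1} = 0`** in the [B7]-Prop-4 regime at a unitary `W` (`0 < α₀`, `C0·α₀ ≤ 1∕3`, `4α₀ ≤ c2′`, `pdev W < α₀(L^{j+1})⁻²`, `sup‖X‖ ≤ b`, the `hsmall` and `hc₃` lines):
the top composite is `mlog U̿′^{j+1}` ([Balaban1985Averaging] (123)'s dictionary), and `U̿′^{j+1} = 1`. [folklore] -/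
theorem logCovIter_top_eq_zero_of_dbar [Nonempty n] {L : ℕ} (hL : 2 ≤ L) (j : ℕ) {W : Site d → Fin d → (Matrix n n ℂ)ˣ} (hWu : IsUnitaryCfg W)
    {X : Site d → Fin d → Matrix n n ℂ} {α₀ b : ℝ} (hα : 0 < α₀) (hα3 : C0 d * α₀ ≤ 1 / 3) (hα4 : 4 * α₀ ≤ c2' d L)
    (h52 : pdev W < α₀ * (((L : ℝ) ^ (j + 1))⁻¹) ^ 2) (hb : 0 ≤ b) (hX : ∀ (y : Site d) (κ : Fin d), ‖X y κ‖ ≤ b)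
    (hsmall : Real.exp (4 * (800 * ((d : ℝ) + 1) ^ 2 * ((d : ℝ) + 4)) * α₀)
      * (1 + 8 * (131072 * ((d : ℝ) + 1) ^ 2) * ((L : ℝ) ^ (j + 1) * b)) ≤ 2)
    (hc₃ : 2 * ((L : ℝ) ^ (j + 1) * b) ≤ c3 d L)
    (hdbar : dbavgCovIter L W (relPert W X) (j + 1) = 1) (z : Site d) (κ : Fin d) :
    logCovIter L W (adField W X) (j + 1) z κ = 0 := by
  letI : CStarAlgebra (Matrix n n ℂ) := {}
  have hG := avgClosed_unitaryUnits d (𝔸 := Matrix n n ℂ) L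
  have hU₀ : ∀ (y : Site d) (κ : Fin d), W y κ ∈ unitaryUnits (Matrix n n ℂ) := hWu
  have hBsup : ∀ (y : Site d) (κ : Fin d), ‖adField W X y κ‖ ≤ b := fun y κ => by
    unfold adField; rw [AveragingDeficitTransport.norm_Ad_of_unitary (hWu y κ)]; exact hX y κ
  have hQ := dbavgCovIter_eq_expCfg_logCovIter L hL hG (j + 1) W hU₀ hα hα3 hα4 h52 (adField W X) hb hBsup hsmall hc₃
  rw [logCovIter_succ_eq_mlog_dbavgCovIter L W (adField W X) j (hQ j (by omega)), ← relPert_eq_expCfg_adField, hdbar]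
  simp

/-! ## §2 (Γ1) read at a trivial top double-bar field: R26′ verbatim -/

/-- **(Γ1)-ℓ¹ UNDER `hdbar`**: `dirL1 (QbarIter L (j+1) W X) [0,N)^d ≤ 64C₁L²d(4L+1)^d·((L∕L^d)L)^j·l2sq X` (hypotheses of `NE7QbarIterL1DbarFree.dirL1_QbarIter_sub_le` + `hdbar`). [folklore] -/
theorem dirL1_QbarIter_le_of_dbar [Nonempty n] {L N : ℕ} (hL : 2 ≤ L) (hN : 1 ≤ N) (j : ℕ)
    {W : Site d → Fin d → (Matrix n n ℂ)ˣ} {x : ℝ} (hWu : IsUnitaryCfg W) (hWP : IsPeriodicCfg W ((N * L ^ (j + 1) : ℕ) : ℤ))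
    (hx : 0 ≤ x) (hsm : LevelSmall d L j x) (hWx : SmallField W x)
    {α₀ b : ℝ} (hα : 0 < α₀) (hα3 : C0 d * (2 * α₀) ≤ 1 / 3) (hα4 : 4 * (2 * α₀) ≤ c2' d L)
    (h52 : pdev W < α₀ * (((L : ℝ) ^ (j + 1))⁻¹) ^ 2) (hb : 0 ≤ b)
    {X : Site d → Fin d → Matrix n n ℂ} (hX : ∀ (y : Site d) (κ : Fin d), ‖X y κ‖ ≤ b) (hXP : IsPeriodicDir X ((N * L ^ (j + 1) : ℕ) : ℤ))
    (hsmall : Real.exp (4 * (800 * ((d : ℝ) + 1) ^ 2 * ((d : ℝ) + 4)) * α₀)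
      * (1 + 8 * (131072 * ((d : ℝ) + 1) ^ 2) * ((L : ℝ) ^ (j + 1) * b)) ≤ 2)
    (hc₃ : 4 * ((L : ℝ) ^ (j + 1) * b) ≤ c3 d L)
    (hK : 16 * (C1cov d * (L : ℝ) ^ 2 * Real.sqrt (d * (2 * (2 * L) + 1) ^ d)) * (L : ℝ) ^ (j + 1) * b ≤ Real.sqrt ((L : ℝ) ^ 2 / (L : ℝ) ^ d))
    (hS1 : (16 * (d + 1) * (d + 4) * (L : ℝ) ^ 2 * Csup d L * (d * (2 * nbRad d L + 1) ^ d)) * radSum d L j x ≤ ((L : ℝ) / (L : ℝ) ^ d) / 2)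
    (hdbar : dbavgCovIter L W (relPert W X) (j + 1) = 1) :
    dirL1 (QbarIter L (j + 1) W X) (periodBox (d := d) N)
      ≤ 64 * (C1cov d * (L : ℝ) ^ 2 * (d * (2 * (2 * (L : ℝ)) + 1) ^ d)) * (((L : ℝ) / (L : ℝ) ^ d) * L) ^ (j + 1 - 1)
          * l2sq (periodBox (d := d) (N * L ^ (j + 1))) X := by
  have hα3' : C0 d * α₀ ≤ 1 / 3 := by
    have hC : 0 ≤ C0 d := by unfold C0; positivity
    nlinarith
  have hα4' : 4 * α₀ ≤ c2' d L := by linarith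
  have hL0 : (0 : ℝ) < L := by exact_mod_cast (show 0 < L by omega)
  have hc₃' : 2 * ((L : ℝ) ^ (j + 1) * b) ≤ c3 d L := by nlinarith [pow_pos hL0 (j + 1)]
  have h := dirL1_QbarIter_sub_le hL hN j hWu hWP hx hsm hWx hα hα3 hα4 h52 hb hX hXP hsmall hc₃ hK hS1
  have e : (fun z κ => QbarIter L (j + 1) W X z κ - Ad ((cavgIter L (j + 1) W) z κ)⁻¹ (logCovIter L W (adField W X) (j + 1) z κ))
      = QbarIter L (j + 1) W X := by
    funext z κ
    rw [logCovIter_top_eq_zero_of_dbar hL j hWu hα hα3' hα4' h52 hb hX hsmall hc₃' hdbar z κ, Ad_zero, sub_zero]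
  rw [e] at h
  exact h

/-- **(Γ1)-ℓ² UNDER `hdbar`**: `√l2sq [0,N)^d (QbarIter L (j+1) W X) ≤ 32C₁L²√(d(4L+1)^d)·√l2sq X·b·(√(L²∕L^d)L)^j`. [folklore] -/
theorem sqrt_l2sq_QbarIter_le_of_dbar [Nonempty n] {L N : ℕ} (hL : 2 ≤ L) (hN : 1 ≤ N) (j : ℕ)
    {W : Site d → Fin d → (Matrix n n ℂ)ˣ} {x : ℝ} (hWu : IsUnitaryCfg W) (hWP : IsPeriodicCfg W ((N * L ^ (j + 1) : ℕ) : ℤ))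
    (hx : 0 ≤ x) (hsm : LevelSmall d L j x) (hWx : SmallField W x)
    {α₀ b : ℝ} (hα : 0 < α₀) (hα3 : C0 d * (2 * α₀) ≤ 1 / 3) (hα4 : 4 * (2 * α₀) ≤ c2' d L)
    (h52 : pdev W < α₀ * (((L : ℝ) ^ (j + 1))⁻¹) ^ 2) (hb : 0 ≤ b)
    {X : Site d → Fin d → Matrix n n ℂ} (hX : ∀ (y : Site d) (κ : Fin d), ‖X y κ‖ ≤ b) (hXP : IsPeriodicDir X ((N * L ^ (j + 1) : ℕ) : ℤ))
    (hsmall : Real.exp (4 * (800 * ((d : ℝ) + 1) ^ 2 * ((d : ℝ) + 4)) * α₀)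
      * (1 + 8 * (131072 * ((d : ℝ) + 1) ^ 2) * ((L : ℝ) ^ (j + 1) * b)) ≤ 2)
    (hc₃ : 4 * ((L : ℝ) ^ (j + 1) * b) ≤ c3 d L)
    (hK : 16 * (C1cov d * (L : ℝ) ^ 2 * Real.sqrt (d * (2 * (2 * L) + 1) ^ d)) * (L : ℝ) ^ (j + 1) * b ≤ Real.sqrt ((L : ℝ) ^ 2 / (L : ℝ) ^ d))
    (hdbar : dbavgCovIter L W (relPert W X) (j + 1) = 1) :
    Real.sqrt (l2sq (periodBox (d := d) N) (QbarIter L (j + 1) W X))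
      ≤ 32 * (C1cov d * (L : ℝ) ^ 2 * Real.sqrt (d * (2 * (2 * L) + 1) ^ d))
          * Real.sqrt (l2sq (periodBox (d := d) (N * L ^ (j + 1))) X) * b * (Real.sqrt ((L : ℝ) ^ 2 / (L : ℝ) ^ d) * L) ^ (j + 1 - 1) := by
  have hα3' : C0 d * α₀ ≤ 1 / 3 := by
    have hC : 0 ≤ C0 d := by unfold C0; positivity
    nlinarith
  have hα4' : 4 * α₀ ≤ c2' d L := by linarith
  have hL0 : (0 : ℝ) < L := by exact_mod_cast (show 0 < L by omega)
  have hc₃' : 2 * ((L : ℝ) ^ (j + 1) * b) ≤ c3 d L := by nlinarith [pow_pos hL0 (j + 1)]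
  have h := sqrt_l2sq_QbarIter_sub_le hL hN j hWu hWP hx hsm hWx hα hα3 hα4 h52 hb hX hXP hsmall hc₃ hK
  have e : (fun z κ => QbarIter L (j + 1) W X z κ - Ad ((cavgIter L (j + 1) W) z κ)⁻¹ (logCovIter L W (adField W X) (j + 1) z κ))
      = QbarIter L (j + 1) W X := by
    funext z κ
    rw [logCovIter_top_eq_zero_of_dbar hL j hWu hα hα3' hα4' h52 hb hX hsmall hc₃' hdbar z κ, Ad_zero, sub_zero]
  rw [e] at h
  exact h

/-! ## §3 The two direct letters in the energy currency, under `hdbar` -/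

/-- **(DL1) UNDER `hdbar`**: `(M^d∕M⁴)·dirL1 (QbarIter L (j+1) W X) [0,N)^d ≤ (64·C1cov·L²d(4L+1)^d·(L^d∕L²))·‖X‖_w²`, `‖X‖_w = energyNormW L (j+1) W X [0,N·M)^d` — gen 97's k-FREE `q₁`,
now for every gauge realising `hdbar`. [folklore] -/
theorem directLetter_L1_of_dbar [Nonempty n] {L N : ℕ} (hL : 2 ≤ L) (hN : 1 ≤ N) (j : ℕ)
    {W : Site d → Fin d → (Matrix n n ℂ)ˣ} {x : ℝ} (hWu : IsUnitaryCfg W) (hWP : IsPeriodicCfg W ((N * L ^ (j + 1) : ℕ) : ℤ))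
    (hx : 0 ≤ x) (hsm : LevelSmall d L j x) (hWx : SmallField W x)
    {α₀ b : ℝ} (hα : 0 < α₀) (hα3 : C0 d * (2 * α₀) ≤ 1 / 3) (hα4 : 4 * (2 * α₀) ≤ c2' d L)
    (h52 : pdev W < α₀ * (((L : ℝ) ^ (j + 1))⁻¹) ^ 2) (hb : 0 ≤ b)
    {X : Site d → Fin d → Matrix n n ℂ} (hX : ∀ (y : Site d) (κ : Fin d), ‖X y κ‖ ≤ b) (hXP : IsPeriodicDir X ((N * L ^ (j + 1) : ℕ) : ℤ))
    (hsmall : Real.exp (4 * (800 * ((d : ℝ) + 1) ^ 2 * ((d : ℝ) + 4)) * α₀)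
      * (1 + 8 * (131072 * ((d : ℝ) + 1) ^ 2) * ((L : ℝ) ^ (j + 1) * b)) ≤ 2)
    (hc₃ : 4 * ((L : ℝ) ^ (j + 1) * b) ≤ c3 d L)
    (hK : 16 * (C1cov d * (L : ℝ) ^ 2 * Real.sqrt (d * (2 * (2 * L) + 1) ^ d)) * (L : ℝ) ^ (j + 1) * b ≤ Real.sqrt ((L : ℝ) ^ 2 / (L : ℝ) ^ d))
    (hS1 : (16 * (d + 1) * (d + 4) * (L : ℝ) ^ 2 * Csup d L * (d * (2 * nbRad d L + 1) ^ d)) * radSum d L j x ≤ ((L : ℝ) / (L : ℝ) ^ d) / 2)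
    (hdbar : dbavgCovIter L W (relPert W X) (j + 1) = 1) :
    ((L : ℝ) ^ (j + 1)) ^ d / ((L : ℝ) ^ (j + 1)) ^ 4 * dirL1 (QbarIter L (j + 1) W X) (periodBox (d := d) N)
      ≤ (64 * (C1cov d * (L : ℝ) ^ 2 * (d * (2 * (2 * (L : ℝ)) + 1) ^ d)) * ((L : ℝ) ^ d / (L : ℝ) ^ 2))
          * energyNormW L (j + 1) W X (periodBox (d := d) (N * L ^ (j + 1))) ^ 2 := by
  have hL0 : (0 : ℝ) < L := by exact_mod_cast (show 0 < L by omega)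
  have h := dirL1_QbarIter_le_of_dbar hL hN j hWu hWP hx hsm hWx hα hα3 hα4 h52 hb hX hXP hsmall hc₃ hK hS1 hdbar
  set K₁ : ℝ := 64 * (C1cov d * (L : ℝ) ^ 2 * (d * (2 * (2 * (L : ℝ)) + 1) ^ d)) with hK₁
  have hK₁0 : 0 ≤ K₁ := by rw [hK₁]; have := C1cov_pos d; positivity
  set E2 : ℝ := energyNormW L (j + 1) W X (periodBox (d := d) (N * L ^ (j + 1))) ^ 2 with hE2
  have hMd0 : 0 ≤ ((L : ℝ) ^ (j + 1)) ^ d / ((L : ℝ) ^ (j + 1)) ^ 4 := by positivity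
  have hEn := inv_sq_mul_l2sq_le_energySq L j W X (periodBox (d := d) (N * L ^ (j + 1)))
  calc ((L : ℝ) ^ (j + 1)) ^ d / ((L : ℝ) ^ (j + 1)) ^ 4 * dirL1 (QbarIter L (j + 1) W X) (periodBox (d := d) N)
      ≤ ((L : ℝ) ^ (j + 1)) ^ d / ((L : ℝ) ^ (j + 1)) ^ 4 * (K₁ * (((L : ℝ) / (L : ℝ) ^ d) * L) ^ (j + 1 - 1) * l2sq (periodBox (d := d) (N * L ^ (j + 1))) X) :=
        mul_le_mul_of_nonneg_left h hMd0
    _ = K₁ * (((L : ℝ) ^ (j + 1)) ^ d / ((L : ℝ) ^ (j + 1)) ^ 4 * (((L : ℝ) / (L : ℝ) ^ d) * L) ^ (j + 1 - 1)) * l2sq (periodBox (d := d) (N * L ^ (j + 1))) X := by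
        ring
    _ = K₁ * ((L : ℝ) ^ d / (L : ℝ) ^ 2 * (((L : ℝ) ^ (j + 1)) ^ 2)⁻¹) * l2sq (periodBox (d := d) (N * L ^ (j + 1))) X := by
        rw [pow_identity_L1 (d := d) hL0 j]
    _ = K₁ * ((L : ℝ) ^ d / (L : ℝ) ^ 2) * ((((L : ℝ) ^ (j + 1)) ^ 2)⁻¹ * l2sq (periodBox (d := d) (N * L ^ (j + 1))) X) := by ring
    _ ≤ K₁ * ((L : ℝ) ^ d / (L : ℝ) ^ 2) * E2 := mul_le_mul_of_nonneg_left hEn (by positivity)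

/-- **(DL2) UNDER `hdbar`**: `(M^d∕M⁴)·dirSq (QbarIter L (j+1) W X) [0,N)^d ≤ (1024·K²·(L^d∕L⁴)·(M·b)²)·‖X‖_w²`, `K = C1cov·L²√(d(4L+1)^d)` — gen 97's `q₂² = C·α̂²`, for every gauge
realising `hdbar`. [folklore] -/
theorem directLetter_L2_of_dbar [Nonempty n] {L N : ℕ} (hL : 2 ≤ L) (hN : 1 ≤ N) (j : ℕ)
    {W : Site d → Fin d → (Matrix n n ℂ)ˣ} {x : ℝ} (hWu : IsUnitaryCfg W) (hWP : IsPeriodicCfg W ((N * L ^ (j + 1) : ℕ) : ℤ))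
    (hx : 0 ≤ x) (hsm : LevelSmall d L j x) (hWx : SmallField W x)
    {α₀ b : ℝ} (hα : 0 < α₀) (hα3 : C0 d * (2 * α₀) ≤ 1 / 3) (hα4 : 4 * (2 * α₀) ≤ c2' d L)
    (h52 : pdev W < α₀ * (((L : ℝ) ^ (j + 1))⁻¹) ^ 2) (hb : 0 ≤ b)
    {X : Site d → Fin d → Matrix n n ℂ} (hX : ∀ (y : Site d) (κ : Fin d), ‖X y κ‖ ≤ b) (hXP : IsPeriodicDir X ((N * L ^ (j + 1) : ℕ) : ℤ))
    (hsmall : Real.exp (4 * (800 * ((d : ℝ) + 1) ^ 2 * ((d : ℝ) + 4)) * α₀)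
      * (1 + 8 * (131072 * ((d : ℝ) + 1) ^ 2) * ((L : ℝ) ^ (j + 1) * b)) ≤ 2)
    (hc₃ : 4 * ((L : ℝ) ^ (j + 1) * b) ≤ c3 d L)
    (hK : 16 * (C1cov d * (L : ℝ) ^ 2 * Real.sqrt (d * (2 * (2 * L) + 1) ^ d)) * (L : ℝ) ^ (j + 1) * b ≤ Real.sqrt ((L : ℝ) ^ 2 / (L : ℝ) ^ d))
    (hdbar : dbavgCovIter L W (relPert W X) (j + 1) = 1) :
    ((L : ℝ) ^ (j + 1)) ^ d / ((L : ℝ) ^ (j + 1)) ^ 4 * dirSq (QbarIter L (j + 1) W X) (periodBox (d := d) N)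
      ≤ (1024 * (C1cov d * (L : ℝ) ^ 2 * Real.sqrt (d * (2 * (2 * L) + 1) ^ d)) ^ 2 * ((L : ℝ) ^ d / (L : ℝ) ^ 4) * ((L : ℝ) ^ (j + 1) * b) ^ 2)
          * energyNormW L (j + 1) W X (periodBox (d := d) (N * L ^ (j + 1))) ^ 2 := by
  have hL0 : (0 : ℝ) < L := by exact_mod_cast (show 0 < L by omega)
  have h := sqrt_l2sq_QbarIter_le_of_dbar hL hN j hWu hWP hx hsm hWx hα hα3 hα4 h52 hb hX hXP hsmall hc₃ hK hdbar
  set K : ℝ := C1cov d * (L : ℝ) ^ 2 * Real.sqrt (d * (2 * (2 * L) + 1) ^ d) with hKdef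
  have hK0 : 0 ≤ K := by rw [hKdef]; have := C1cov_pos d; positivity
  set ρ : ℝ := Real.sqrt ((L : ℝ) ^ 2 / (L : ℝ) ^ d) with hρ
  set EX : ℝ := l2sq (periodBox (d := d) (N * L ^ (j + 1))) X with hEX
  have hEX0 : 0 ≤ EX := l2sq_nonneg _ _
  set E2 : ℝ := energyNormW L (j + 1) W X (periodBox (d := d) (N * L ^ (j + 1))) ^ 2 with hE2
  have h0 : 0 ≤ l2sq (periodBox (d := d) N) (QbarIter L (j + 1) W X) := l2sq_nonneg _ _
  have hsq : dirSq (QbarIter L (j + 1) W X) (periodBox (d := d) N) ≤ (32 * K * Real.sqrt EX * b * (ρ * L) ^ (j + 1 - 1)) ^ 2 := by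
    have h1 := pow_le_pow_left₀ (Real.sqrt_nonneg _) h 2
    rw [Real.sq_sqrt h0] at h1
    exact h1
  have hMd0 : 0 ≤ ((L : ℝ) ^ (j + 1)) ^ d / ((L : ℝ) ^ (j + 1)) ^ 4 := by positivity
  have hEn := inv_sq_mul_l2sq_le_energySq L j W X (periodBox (d := d) (N * L ^ (j + 1)))
  have hid := pow_identity_L2 (d := d) hL0 j
  calc ((L : ℝ) ^ (j + 1)) ^ d / ((L : ℝ) ^ (j + 1)) ^ 4 * dirSq (QbarIter L (j + 1) W X) (periodBox (d := d) N)
      ≤ ((L : ℝ) ^ (j + 1)) ^ d / ((L : ℝ) ^ (j + 1)) ^ 4 * (32 * K * Real.sqrt EX * b * (ρ * L) ^ (j + 1 - 1)) ^ 2 := mul_le_mul_of_nonneg_left hsq hMd0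
    _ = 1024 * K ^ 2 * (((L : ℝ) ^ (j + 1)) ^ d / ((L : ℝ) ^ (j + 1)) ^ 4 * ((ρ * L) ^ (j + 1 - 1)) ^ 2) * b ^ 2 * Real.sqrt EX ^ 2 := by ring
    _ = 1024 * K ^ 2 * ((L : ℝ) ^ d / (L : ℝ) ^ 4) * b ^ 2 * EX := by rw [hid, Real.sq_sqrt hEX0]
    _ = 1024 * K ^ 2 * ((L : ℝ) ^ d / (L : ℝ) ^ 4) * ((L : ℝ) ^ (j + 1) * b) ^ 2 * ((((L : ℝ) ^ (j + 1)) ^ 2)⁻¹ * EX) := by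
        have hM0 : ((L : ℝ) ^ (j + 1)) ^ 2 ≠ 0 := by positivity
        field_simp
    _ ≤ 1024 * K ^ 2 * ((L : ℝ) ^ d / (L : ℝ) ^ 4) * ((L : ℝ) ^ (j + 1) * b) ^ 2 * E2 := mul_le_mul_of_nonneg_left hEn (by positivity)

/-! ## §4 `hdbar` at NE7's pair for ANY unitary gauge whose corner values are the accumulated frame -/

/-- **S2′'s TARGET CONDITION IMPLIES `hdbar`** (row NE3's `dbar_of_frame_eq` at NE7's pair; NO corner-triviality): `U_A^{u} = W·e^{X}`, `Ū_A^{j+1} = D = W̄^{j+1}`, and the CORNER VALUES of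
`u` equal the accumulated frame, `vcov L W (relPert W X) (j+1) = uLev L u (j+1)` ⟹ `U̿′^{j+1} = 1`.  With `u` corner-trivial this is gen 97's `v_{j+1} ≡ 1`. [folklore] -/
theorem dbar_of_frame_eq_corner (L j : ℕ) {u : Site d → (Matrix n n ℂ)ˣ} {UA W D : Site d → Fin d → (Matrix n n ℂ)ˣ} {X : Site d → Fin d → Matrix n n ℂ}
    (hrep : gaugeAct u UA = vary W X 1) (hA : avgIter L UA (j + 1) = D) (hW : avgIter L W (j + 1) = D)
    (hframe : vcov L W (relPert W X) (j + 1) = uLev L u (j + 1)) :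
    dbavgCovIter L W (relPert W X) (j + 1) = 1 :=
  dbar_of_frame_eq L (j + 1) hrep hA hW hframe

/-- The corner-trivial special case: `u(L^{j+1}•z) = 1` and `v_{j+1} ≡ 1` give `hframe`, hence `hdbar`. [folklore] -/
theorem dbar_of_frameTrivial (L j : ℕ) {u : Site d → (Matrix n n ℂ)ˣ} {UA W D : Site d → Fin d → (Matrix n n ℂ)ˣ} {X : Site d → Fin d → Matrix n n ℂ}
    (hrep : gaugeAct u UA = vary W X 1) (hcorner : ∀ z : Site d, u (((L : ℤ) ^ (j + 1)) • z) = 1)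
    (hA : avgIter L UA (j + 1) = D) (hW : avgIter L W (j + 1) = D) (hv1 : ∀ z : Site d, vcov L W (relPert W X) (j + 1) z = 1) :
    dbavgCovIter L W (relPert W X) (j + 1) = 1 := by
  refine dbar_of_frame_eq_corner L j hrep hA hW ?_
  funext z
  rw [hv1 z]
  exact (hcorner z).symm

end

end Summit.QuantumFields.BalabanUV.T4Continuum.NE7DbarQbarLetters
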